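import Literature.Topology.FourManifolds.ShrinkScaleUniform
import HarnessLib

/-!
# The exit bend: rotating the upper spike of the shrunk knot onto the line of the lower spike

Topic `Literature/Topology/FourManifolds` (trunk T-4MAN). Fact seat
`provefact-Literature.Topology.FourManifolds.Knot.IsConnectedSum.isIsotopic` (Schubert's theorem),
geometric heart for rail knots. After the southern content of a wall frame has been contracted by
the ratio `λ₀` towards the centre `oS` (`WallScaling.lean`, `ShrinkScaleUniform.lean`), the shrunk
knot enters the small ball around `oS` along the lower straight spike (direction `-dLo`,
`dLo = O - baseLo` in blow-up coordinates, `O = (1, 0, σ)`) and leaves it along the upper straight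
spike (direction `dHi = baseHi - O`), at an angle. The insertion arguments to follow need the knot
to be *straight through* the small ball. This file bends the exit: the flow of a compactly
supported vector field of `𝕊³`, given in the chart `ψ` (`ChartFieldFlow.lean`), which in blow-up
coordinates is the **elliptic rotation** `v ↦ β(v) dLo - α(v) dHi` of the plane
`O + span(dLo, dHi)` (`α, β` the coordinates in the basis `dLo, dHi`), cut off to an annulus in
the coordinate radius `√(α² + β²)` (outside the unit, inside the junctions), to a slab around the
plane, and to an angular sector away from the lower spike. Its time-one map rotates the segment
`{O + ρ dHi : 2 r_A ≤ ρ ≤ 1/2}` of the upper spike rigidly (in coordinates, by the angle `π/2`)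
onto `{O + ρ dLo}`, the continuation of the lower spike beyond `O`, moves the rest of the upper
spike inside the coordinate radius `3/4` along explicit ellipse arcs, and fixes every other point
of the shrunk knot. Being the end stage of an ambient isotopy, it yields an isotopic knot for free
(`isAmbientIsotopic_flow`).

Contents: § coordinate geometry of the rotation (`ExitBend.dLo`, `dHi`, the dual basis, the
coordinate forms `aCL`, `bCL`, the normal part `vPerp`, the cut-offs and the field `bendField`, its
smoothness, the explicit trajectories `bendArc` and the support bound); § the chart field of
band-sum data `b` (`BandData.bendChartField`), compact support, the flow and its tracks; § the
fixed points (flat walls, far walls, the lower spike, the unit) and the moved points (the upper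
spike); § **the bent knot** `b.bentKnot` of a wall frame with its isotopy
`isIsotopic_wallShrinkKnotU_bentKnot` (and `isIsotopic_frameKnot_bentKnot`) and its pointwise description
(`bentKnot_circlePt_of_not_mem`, `…_lowerSpike`, `…_upperSpike(_of_mem/_of_ge)`, `…_general`), for
**clear** wall frames (`BandData.IsBendClear`: points off the content set are points of the spiked
knot of `b` or lie at blow-up distance `≥ 2` from `O`).

Everything is proved; no named facts are introduced.

## References

* M. W. Hirsch, *Differential Topology*, GTM 33, Springer (1976), Ch. 8 §1, Thms. 1.1–1.3.
  [HirschDT1976]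
* J. M. Lee, *Introduction to Smooth Manifolds*, 2nd ed., GTM 218 (2012), Thm. 9.12 (flows).
  [LeeSmoothManifolds2013]
-/

open scoped Manifold ContDiff Topology Real RealInnerProductSpace
open Function Set Metric Filter

noncomputable section

namespace Literature.Topology.FourManifolds

/-- Local notation: `𝔼 n` is the model Euclidean space `EuclideanSpace ℝ (Fin n)`. -/
local notation "𝔼 " n:arg => EuclideanSpace ℝ (Fin n)

/-- Local notation: `𝕊 n` is the unit sphere in `EuclideanSpace ℝ (Fin (n + 1))`. -/
local notation "𝕊 " n:arg => (Metric.sphere (0 : EuclideanSpace ℝ (Fin (n + 1))) 1)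

attribute [local instance] fact_finrank_euclideanSpace_succ

open KnotsInBall

namespace ExitBend

/-! ### Coordinate geometry of the rotation -/

/-- Inner products of coordinate points. [folklore] -/
theorem inner_pt3_pt3 (a b c x y z : ℝ) : ⟪(pt3 a b c : 𝔼 3), pt3 x y z⟫ = a * x + b * y + c * z := by
  simp [pt3, PiLp.inner_apply, Fin.sum_univ_three]; ring

/-- Inner product with a coordinate point on the left. [folklore] -/
theorem inner_pt3_left (a b c : ℝ) (v : 𝔼 3) : ⟪(pt3 a b c : 𝔼 3), v⟫ = a * v 0 + b * v 1 + c * v 2 := by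
  simp [pt3, PiLp.inner_apply, Fin.sum_univ_three]; ring

variable (σ : ℝ)

/-- The centre `O = (1, 0, σ)` in blow-up coordinates. [folklore] -/
def cO : 𝔼 3 := pt3 1 0 σ

/-- The lower spike direction `dLo = O - baseLo = (3/4, 1, σ)`. [folklore] -/
def dLo : 𝔼 3 := pt3 (3 / 4) 1 σ

/-- The upper spike direction `dHi = baseHi - O = (-3/4, 1, -σ)`. [folklore] -/
def dHi : 𝔼 3 := pt3 (-(3 / 4)) 1 (-σ)

/-- The dual vector of `dLo` in the plane `span(dLo, dHi)` (for `σ² = 1`). [folklore] -/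
def dLoDual : 𝔼 3 := pt3 (6 / 25) (1 / 2) (8 * σ / 25)

/-- The dual vector of `dHi`. [folklore] -/
def dHiDual : 𝔼 3 := pt3 (-(6 / 25)) (1 / 2) (-(8 * σ / 25))

/-- The first coordinate form `α(v) = ⟪dLoDual, v⟫`. [folklore] -/
def aCL : 𝔼 3 →L[ℝ] ℝ := innerSL ℝ (dLoDual σ)

/-- The second coordinate form `β(v) = ⟪dHiDual, v⟫`. [folklore] -/
def bCL : 𝔼 3 →L[ℝ] ℝ := innerSL ℝ (dHiDual σ)

/-- The first coordinate form is the inner product with `dLoDual`. [folklore] -/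
@[simp] theorem aCL_apply (v : 𝔼 3) : aCL σ v = ⟪dLoDual σ, v⟫ := rfl
/-- The second coordinate form is the inner product with `dHiDual`. [folklore] -/
@[simp] theorem bCL_apply (v : 𝔼 3) : bCL σ v = ⟪dHiDual σ, v⟫ := rfl

variable {σ} (hσ : σ ^ 2 = 1)
include hσ

/-- `α(dLo) = 1`. [folklore] -/
theorem aCL_dLo : aCL σ (dLo σ) = 1 := by
  rw [aCL_apply, dLoDual, dLo, inner_pt3_pt3]; nlinarith
/-- `α(dHi) = 0`. [folklore] -/
theorem aCL_dHi : aCL σ (dHi σ) = 0 := by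
  rw [aCL_apply, dLoDual, dHi, inner_pt3_pt3]; nlinarith
/-- `β(dLo) = 0`. [folklore] -/
theorem bCL_dLo : bCL σ (dLo σ) = 0 := by
  rw [bCL_apply, dHiDual, dLo, inner_pt3_pt3]; nlinarith
/-- `β(dHi) = 1`. [folklore] -/
theorem bCL_dHi : bCL σ (dHi σ) = 1 := by
  rw [bCL_apply, dHiDual, dHi, inner_pt3_pt3]; nlinarith
/-- `‖dLo‖² = 41/16`. [folklore] -/
theorem norm_dLo_sq : ‖dLo σ‖ ^ 2 = 41 / 16 := by
  rw [← real_inner_self_eq_norm_sq, dLo, inner_pt3_pt3]; nlinarith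
/-- `‖dHi‖² = 41/16`. [folklore] -/
theorem norm_dHi_sq : ‖dHi σ‖ ^ 2 = 41 / 16 := by
  rw [← real_inner_self_eq_norm_sq, dHi, inner_pt3_pt3]; nlinarith
/-- `⟪dLo, dHi⟫ = -9/16`. [folklore] -/
theorem inner_dLo_dHi : ⟪dLo σ, dHi σ⟫ = -(9 / 16) := by
  rw [dLo, dHi, inner_pt3_pt3]; nlinarith

omit hσ in
/-- `‖dLoDual‖²` as a polynomial in `σ²`. [folklore] -/
theorem norm_dLoDual_sq_le : ‖dLoDual σ‖ ^ 2 = 41 / 100 + (σ ^ 2 - 1) * 64 / 625 := by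
  rw [← real_inner_self_eq_norm_sq, dLoDual, inner_pt3_pt3]; ring

/-- `‖dLoDual‖ ≤ 13/20`. [folklore] -/
theorem norm_dLoDual_le : ‖dLoDual σ‖ ≤ 13 / 20 := by
  have h := norm_dLoDual_sq_le (σ := σ)
  rw [hσ] at h
  nlinarith [norm_nonneg (dLoDual σ)]

/-- `‖dHiDual‖ ≤ 13/20`. [folklore] -/
theorem norm_dHiDual_le : ‖dHiDual σ‖ ≤ 13 / 20 := by
  have h : ‖dHiDual σ‖ ^ 2 = 41 / 100 := by
    rw [← real_inner_self_eq_norm_sq, dHiDual, inner_pt3_pt3]; nlinarith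
  nlinarith [norm_nonneg (dHiDual σ)]

omit hσ in
/-- `|α(v)| ≤ ‖dLoDual‖ ‖v‖`. [folklore] -/
theorem abs_aCL_le (v : 𝔼 3) : |aCL σ v| ≤ ‖dLoDual σ‖ * ‖v‖ := by
  rw [aCL_apply]; exact abs_real_inner_le_norm _ _

omit hσ in
/-- `|β(v)| ≤ ‖dHiDual‖ ‖v‖`. [folklore] -/
theorem abs_bCL_le (v : 𝔼 3) : |bCL σ v| ≤ ‖dHiDual σ‖ * ‖v‖ := by
  rw [bCL_apply]; exact abs_real_inner_le_norm _ _

omit hσ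
variable (σ)

/-- The part of `v` normal to the plane `span(dLo, dHi)` (along the plane's complement):
`v - α(v) dLo - β(v) dHi`. [folklore] -/
def vPerp (v : 𝔼 3) : 𝔼 3 := v - aCL σ v • dLo σ - bCL σ v • dHi σ

/-- `α(v) dLo + β(v) dHi + v⊥ = v`. [folklore] -/
theorem vPerp_add_eq (v : 𝔼 3) : aCL σ v • dLo σ + bCL σ v • dHi σ + vPerp σ v = v := by
  rw [vPerp]; abel

/-- The normal part is `C^∞` (linear). [folklore] -/
theorem contDiff_vPerp : ContDiff ℝ ∞ (vPerp σ) :=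
  (contDiff_id.sub ((aCL σ).contDiff.smul contDiff_const)).sub ((bCL σ).contDiff.smul contDiff_const)

variable {σ}
include hσ in
/-- A vector in the plane has no normal part. [folklore] -/
theorem vPerp_of_mem (a c : ℝ) : vPerp σ (a • dLo σ + c • dHi σ) = 0 := by
  simp only [vPerp, map_add, map_smul, smul_eq_mul, aCL_dLo hσ, aCL_dHi hσ, bCL_dLo hσ, bCL_dHi hσ,
    mul_one, mul_zero, add_zero, zero_add]
  abel

include hσ in
/-- **The in-plane part is controlled by the coordinates**: `‖a dLo + c dHi‖² ≤ (50/16)(a² + c²)`.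
[folklore] -/
theorem norm_inPlane_sq_le (a c : ℝ) : ‖a • dLo σ + c • dHi σ‖ ^ 2 ≤ 50 / 16 * (a ^ 2 + c ^ 2) := by
  rw [norm_add_sq_real, norm_smul, norm_smul, real_inner_smul_left, real_inner_smul_right, inner_dLo_dHi hσ,
    mul_pow, mul_pow, Real.norm_eq_abs, Real.norm_eq_abs, sq_abs, sq_abs, norm_dLo_sq hσ, norm_dHi_sq hσ]
  nlinarith [sq_nonneg (a + c), sq_nonneg (a - c)]

variable (σ)

/-! ### The cut-offs and the field -/

/-- The annular cut-off in the squared coordinate radius: `0` on `[0, r_A²]`, `1` on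
`[4 r_A², 1/4]`, `0` on `[9/16, ∞)`. [folklore] -/
def annulusCut (rA x : ℝ) : ℝ := smoothStep (rA ^ 2) (4 * rA ^ 2) x * (1 - smoothStep (1 / 4) (9 / 16) x)

/-- The slab cut-off in the squared norm of the normal part: `1` on `[0, 1/16]`, `0` on `[1/4, ∞)`.
[folklore] -/
def slabCut (x : ℝ) : ℝ := 1 - smoothStep (1 / 16) (1 / 4) x

/-- The angular cut-off `S(α / √(α² + β²))`, `S = smoothStep (-7/10) (-1/5)`: `1` on the sector
swept by the upper spike, `0` near the lower spike. [folklore] -/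
def angCut (a c : ℝ) : ℝ := smoothStep (-(7 / 10)) (-(1 / 5)) (a / Real.sqrt (a ^ 2 + c ^ 2))

/-- The annular cut-off takes values in `[0, 1]`. [folklore] -/
theorem annulusCut_mem_Icc (rA x : ℝ) : annulusCut rA x ∈ Icc (0 : ℝ) 1 := by
  have h1 := smoothStep_mem_Icc (rA ^ 2) (4 * rA ^ 2) x
  have h2 := smoothStep_mem_Icc (1 / 4) (9 / 16) x
  exact ⟨mul_nonneg h1.1 (by linarith [h2.2]), mul_le_one₀ h1.2 (by linarith [h2.2]) (by linarith [h2.1])⟩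

/-- The slab cut-off takes values in `[0, 1]`. [folklore] -/
theorem slabCut_mem_Icc (x : ℝ) : slabCut x ∈ Icc (0 : ℝ) 1 := by
  have h := smoothStep_mem_Icc (1 / 16) (1 / 4) x
  exact ⟨by rw [slabCut]; linarith [h.2], by rw [slabCut]; linarith [h.1]⟩

/-- The angular cut-off takes values in `[0, 1]`. [folklore] -/
theorem angCut_mem_Icc (a c : ℝ) : angCut a c ∈ Icc (0 : ℝ) 1 := smoothStep_mem_Icc _ _ _

/-- The annular cut-off vanishes on `[0, r_A²]`. [folklore] -/
theorem annulusCut_of_le {rA x : ℝ} (hrA : 0 < rA) (hx : x ≤ rA ^ 2) : annulusCut rA x = 0 := by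
  rw [annulusCut, smoothStep_of_le (by nlinarith) hx, zero_mul]

/-- The annular cut-off vanishes on `[9/16, ∞)`. [folklore] -/
theorem annulusCut_of_ge {rA x : ℝ} (hx : 9 / 16 ≤ x) : annulusCut rA x = 0 := by
  rw [annulusCut, smoothStep_of_ge (by norm_num) hx]; ring

/-- The annular cut-off is `1` on `[4 r_A², 1/4]`. [folklore] -/
theorem annulusCut_of_mem {rA x : ℝ} (hrA : 0 < rA) (hx : x ∈ Icc (4 * rA ^ 2) (1 / 4)) : annulusCut rA x = 1 := by
  rw [annulusCut, smoothStep_of_ge (by nlinarith) hx.1, smoothStep_of_le (by norm_num) hx.2]; ring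

/-- The slab cut-off is `1` at `0`. [folklore] -/
theorem slabCut_zero : slabCut 0 = 1 := by
  rw [slabCut, smoothStep_of_le (by norm_num) (by norm_num)]; ring

/-- The slab cut-off vanishes on `[1/4, ∞)`. [folklore] -/
theorem slabCut_of_ge {x : ℝ} (hx : 1 / 4 ≤ x) : slabCut x = 0 := by
  rw [slabCut, smoothStep_of_ge (by norm_num) hx]; ring

/-- The angular cut-off vanishes where `α / √(α² + β²) ≤ -7/10`. [folklore] -/
theorem angCut_of_le {a c : ℝ} (h : a / Real.sqrt (a ^ 2 + c ^ 2) ≤ -(7 / 10)) : angCut a c = 0 :=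
  smoothStep_of_le (by norm_num) h

/-- The angular cut-off is `1` where `α / √(α² + β²) ≥ -1/5`. [folklore] -/
theorem angCut_of_ge {a c : ℝ} (h : -(1 / 5) ≤ a / Real.sqrt (a ^ 2 + c ^ 2)) : angCut a c = 1 :=
  smoothStep_of_ge (by norm_num) h

/-- On the negative first axis the angular cut-off vanishes. [folklore] -/
theorem angCut_neg_axis {a : ℝ} (ha : a < 0) : angCut a 0 = 0 := by
  refine angCut_of_le ?_
  have : Real.sqrt (a ^ 2 + 0 ^ 2) = -a := by
    rw [show a ^ 2 + 0 ^ 2 = (-a) ^ 2 by ring, Real.sqrt_sq (by linarith)]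
  rw [this, div_neg, div_self ha.ne]; norm_num

/-- **The coefficient** `c(Y) = annulusCut (α² + β²) · slabCut ‖v⊥‖² · angCut(α, β)`, `v = Y - O`.
[folklore] -/
def bendCoeff (rA : ℝ) (Y : 𝔼 3) : ℝ :=
  annulusCut rA ((aCL σ (Y - cO σ)) ^ 2 + (bCL σ (Y - cO σ)) ^ 2) *
    slabCut (‖vPerp σ (Y - cO σ)‖ ^ 2) * angCut (aCL σ (Y - cO σ)) (bCL σ (Y - cO σ))

/-- **The bend field** in blow-up coordinates: `(π/2) c(Y) (β(v) dLo - α(v) dHi)`, the cut-off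
clockwise rotation of the coordinates `(α, β)`. [folklore] -/
def bendField (rA : ℝ) (Y : 𝔼 3) : 𝔼 3 :=
  (π / 2 * bendCoeff σ rA Y) • (bCL σ (Y - cO σ) • dLo σ - aCL σ (Y - cO σ) • dHi σ)

/-- The coefficient takes values in `[0, 1]`. [folklore] -/
theorem bendCoeff_mem_Icc (rA : ℝ) (Y : 𝔼 3) : bendCoeff σ rA Y ∈ Icc (0 : ℝ) 1 := by
  have h1 := annulusCut_mem_Icc rA ((aCL σ (Y - cO σ)) ^ 2 + (bCL σ (Y - cO σ)) ^ 2)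
  have h2 := slabCut_mem_Icc (‖vPerp σ (Y - cO σ)‖ ^ 2)
  have h3 := angCut_mem_Icc (aCL σ (Y - cO σ)) (bCL σ (Y - cO σ))
  exact ⟨mul_nonneg (mul_nonneg h1.1 h2.1) h3.1, mul_le_one₀ (mul_le_one₀ h1.2 h2.1 h2.2) h3.1 h3.2⟩

/-- Where the coefficient vanishes the field vanishes. [folklore] -/
theorem bendField_of_coeff_eq_zero {rA : ℝ} {Y : 𝔼 3} (h : bendCoeff σ rA Y = 0) : bendField σ rA Y = 0 := by
  rw [bendField, h, mul_zero, zero_smul]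

/-- **Smoothness of the coefficient** (`r_A > 0`): near a point with `α² + β² < r_A²` it vanishes
identically, elsewhere all its factors are smooth (`√` off `0`). [folklore] -/
theorem contDiff_bendCoeff {rA : ℝ} (hrA : 0 < rA) : ContDiff ℝ ∞ (bendCoeff σ rA) := by
  have hv : ContDiff ℝ ∞ (fun Y : 𝔼 3 ↦ Y - cO σ) := contDiff_id.sub contDiff_const
  have ha : ContDiff ℝ ∞ (fun Y : 𝔼 3 ↦ aCL σ (Y - cO σ)) := (aCL σ).contDiff.comp hv
  have hb : ContDiff ℝ ∞ (fun Y : 𝔼 3 ↦ bCL σ (Y - cO σ)) := (bCL σ).contDiff.comp hv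
  have hq : ContDiff ℝ ∞ (fun Y : 𝔼 3 ↦ (aCL σ (Y - cO σ)) ^ 2 + (bCL σ (Y - cO σ)) ^ 2) := (ha.pow 2).add (hb.pow 2)
  have hp : ContDiff ℝ ∞ (fun Y : 𝔼 3 ↦ ‖vPerp σ (Y - cO σ)‖ ^ 2) := ((contDiff_vPerp σ).comp hv).norm_sq ℝ
  have hann : ContDiff ℝ ∞ (fun Y : 𝔼 3 ↦ annulusCut rA ((aCL σ (Y - cO σ)) ^ 2 + (bCL σ (Y - cO σ)) ^ 2)) :=
    ((contDiff_smoothStep _ _).comp hq).mul (contDiff_const.sub ((contDiff_smoothStep _ _).comp hq))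
  have hslab : ContDiff ℝ ∞ (fun Y : 𝔼 3 ↦ slabCut (‖vPerp σ (Y - cO σ)‖ ^ 2)) :=
    contDiff_const.sub ((contDiff_smoothStep _ _).comp hp)
  rw [contDiff_iff_contDiffAt]
  intro Y
  by_cases hY : rA ^ 2 / 2 < (aCL σ (Y - cO σ)) ^ 2 + (bCL σ (Y - cO σ)) ^ 2
  · have hne : (aCL σ (Y - cO σ)) ^ 2 + (bCL σ (Y - cO σ)) ^ 2 ≠ 0 := by nlinarith
    have hsqrt : ContDiffAt ℝ ∞ (fun Y : 𝔼 3 ↦ Real.sqrt ((aCL σ (Y - cO σ)) ^ 2 + (bCL σ (Y - cO σ)) ^ 2)) Y :=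
      hq.contDiffAt.sqrt hne
    have hsqrt_ne : Real.sqrt ((aCL σ (Y - cO σ)) ^ 2 + (bCL σ (Y - cO σ)) ^ 2) ≠ 0 :=
      Real.sqrt_ne_zero'.2 (by nlinarith)
    have hang : ContDiffAt ℝ ∞ (fun Y : 𝔼 3 ↦ angCut (aCL σ (Y - cO σ)) (bCL σ (Y - cO σ))) Y :=
      (contDiff_smoothStep _ _).contDiffAt.comp Y (ha.contDiffAt.div hsqrt hsqrt_ne)
    exact (hann.contDiffAt.mul hslab.contDiffAt).mul hang
  · push Not at hY
    have hopen : IsOpen {Y' : 𝔼 3 | (aCL σ (Y' - cO σ)) ^ 2 + (bCL σ (Y' - cO σ)) ^ 2 < rA ^ 2} :=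
      isOpen_lt hq.continuous continuous_const
    refine (contDiffAt_const (c := (0 : ℝ))).congr_of_eventuallyEq ?_
    have hmem : Y ∈ {Y' : 𝔼 3 | (aCL σ (Y' - cO σ)) ^ 2 + (bCL σ (Y' - cO σ)) ^ 2 < rA ^ 2} := by
      simp only [mem_setOf_eq]; nlinarith
    filter_upwards [hopen.mem_nhds hmem] with Y' hY'
    rw [bendCoeff, annulusCut_of_le hrA (le_of_lt hY')]; ring

/-- **The bend field is `C^∞`.** [folklore] -/
theorem contDiff_bendField {rA : ℝ} (hrA : 0 < rA) : ContDiff ℝ ∞ (bendField σ rA) := by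
  have hv : ContDiff ℝ ∞ (fun Y : 𝔼 3 ↦ Y - cO σ) := contDiff_id.sub contDiff_const
  have ha : ContDiff ℝ ∞ (fun Y : 𝔼 3 ↦ aCL σ (Y - cO σ)) := (aCL σ).contDiff.comp hv
  have hb : ContDiff ℝ ∞ (fun Y : 𝔼 3 ↦ bCL σ (Y - cO σ)) := (bCL σ).contDiff.comp hv
  exact (contDiff_const.mul (contDiff_bendCoeff σ hrA)).smul ((hb.smul contDiff_const).sub (ha.smul contDiff_const))

/-- **Support bound**: where the coefficient is nonzero, `‖Y - O‖ < 2` (in-plane part `< 4/3` by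
`norm_inPlane_sq_le` and `α² + β² < 9/16`, normal part `< 1/2`). [folklore] -/
theorem norm_sub_cO_lt_of_bendCoeff_ne_zero (hσ : σ ^ 2 = 1) {rA : ℝ} {Y : 𝔼 3} (h : bendCoeff σ rA Y ≠ 0) :
    ‖Y - cO σ‖ < 2 := by
  set v := Y - cO σ
  have h1 : annulusCut rA ((aCL σ v) ^ 2 + (bCL σ v) ^ 2) ≠ 0 := fun h0 ↦ h (by rw [bendCoeff, h0]; ring)
  have h2 : slabCut (‖vPerp σ v‖ ^ 2) ≠ 0 := fun h0 ↦ h (by rw [bendCoeff, h0]; ring)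
  have hq : (aCL σ v) ^ 2 + (bCL σ v) ^ 2 < 9 / 16 := by
    by_contra hle; exact h1 (annulusCut_of_ge (not_lt.1 hle))
  have hp : ‖vPerp σ v‖ ^ 2 < 1 / 4 := by
    by_contra hle; exact h2 (slabCut_of_ge (not_lt.1 hle))
  have hin := norm_inPlane_sq_le hσ (aCL σ v) (bCL σ v)
  have hin' : ‖aCL σ v • dLo σ + bCL σ v • dHi σ‖ < 4 / 3 := by
    nlinarith [norm_nonneg (aCL σ v • dLo σ + bCL σ v • dHi σ)]
  have hp' : ‖vPerp σ v‖ < 1 / 2 := by nlinarith [norm_nonneg (vPerp σ v)]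
  calc ‖v‖ = ‖aCL σ v • dLo σ + bCL σ v • dHi σ + vPerp σ v‖ := by rw [vPerp_add_eq]
    _ ≤ ‖aCL σ v • dLo σ + bCL σ v • dHi σ‖ + ‖vPerp σ v‖ := norm_add_le _ _
    _ < 2 := by linarith

/-- Points at distance `≥ 2` from `O` are zeros of the field. [folklore] -/
theorem bendField_eq_zero_of_two_le (hσ : σ ^ 2 = 1) {rA : ℝ} {Y : 𝔼 3} (h : 2 ≤ ‖Y - cO σ‖) : bendField σ rA Y = 0 := by
  refine bendField_of_coeff_eq_zero σ ?_
  by_contra hne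
  exact (not_lt.2 h) (norm_sub_cO_lt_of_bendCoeff_ne_zero σ hσ hne)

/-- Points with squared coordinate radius `≥ 9/16` are zeros of the field. [folklore] -/
theorem bendField_eq_zero_of_radius_ge {rA : ℝ} {Y : 𝔼 3} (h : 9 / 16 ≤ (aCL σ (Y - cO σ)) ^ 2 + (bCL σ (Y - cO σ)) ^ 2) :
    bendField σ rA Y = 0 := by
  refine bendField_of_coeff_eq_zero σ ?_
  rw [bendCoeff, annulusCut_of_ge h]; ring

/-- Points with squared coordinate radius `≤ r_A²` (the unit) are zeros of the field. [folklore] -/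
theorem bendField_eq_zero_of_radius_le {rA : ℝ} (hrA : 0 < rA) {Y : 𝔼 3}
    (h : (aCL σ (Y - cO σ)) ^ 2 + (bCL σ (Y - cO σ)) ^ 2 ≤ rA ^ 2) : bendField σ rA Y = 0 := by
  refine bendField_of_coeff_eq_zero σ ?_
  rw [bendCoeff, annulusCut_of_le hrA h]; ring

/-- **Points of the open lower spike ray `O - ρ dLo`, `ρ > 0`, are zeros of the field** (angular
cut-off). [folklore] -/
theorem bendField_lowerRay (hσ : σ ^ 2 = 1) {rA ρ : ℝ} (hρ : 0 < ρ) : bendField σ rA (cO σ - ρ • dLo σ) = 0 := by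
  refine bendField_of_coeff_eq_zero σ ?_
  have ha : aCL σ (cO σ - ρ • dLo σ - cO σ) = -ρ := by
    rw [sub_sub_cancel_left, map_neg, map_smul, aCL_dLo hσ, smul_eq_mul, mul_one]
  have hb : bCL σ (cO σ - ρ • dLo σ - cO σ) = 0 := by
    rw [sub_sub_cancel_left, map_neg, map_smul, bCL_dLo hσ, smul_eq_mul, mul_zero, neg_zero]
  rw [bendCoeff, ha, hb, angCut_neg_axis (by linarith)]; ring

/-! ### The explicit trajectories -/

/-- **The bend arc** through the upper spike point `O + ρ dHi`: the ellipse arc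
`O + ρ sin x dLo + ρ cos x dHi`, `x = (π/2) c t`, `c = annulusCut (ρ²)`. [folklore] -/
def bendArc (rA ρ t : ℝ) : 𝔼 3 :=
  cO σ + (ρ * Real.sin (π / 2 * annulusCut rA (ρ ^ 2) * t)) • dLo σ + (ρ * Real.cos (π / 2 * annulusCut rA (ρ ^ 2) * t)) • dHi σ

/-- The bend arc starts at the upper spike point `O + ρ dHi`. [folklore] -/
theorem bendArc_zero (rA ρ : ℝ) : bendArc σ rA ρ 0 = cO σ + ρ • dHi σ := by
  simp [bendArc]

/-- Where the annular cut-off is `1`, at time `1` the arc has reached the lower line: `O + ρ dLo`.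
[folklore] -/
theorem bendArc_one_of_eq_one {rA ρ : ℝ} (h : annulusCut rA (ρ ^ 2) = 1) : bendArc σ rA ρ 1 = cO σ + ρ • dLo σ := by
  simp [bendArc, h, Real.sin_pi_div_two, Real.cos_pi_div_two]

/-- Where the annular cut-off is `0` the arc is constant. [folklore] -/
theorem bendArc_of_eq_zero {rA ρ : ℝ} (h : annulusCut rA (ρ ^ 2) = 0) (t : ℝ) : bendArc σ rA ρ t = cO σ + ρ • dHi σ := by
  simp [bendArc, h]

/-- The elementary inequality `sin x ≥ -1/5` for `-1/5 ≤ x ≤ π`. [folklore] -/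
theorem neg_fifth_le_sin {x : ℝ} (h1 : -(1 / 5) ≤ x) (h2 : x ≤ π) : -(1 / 5) ≤ Real.sin x := by
  rcases le_or_gt 0 x with hx | hx
  · linarith [Real.sin_nonneg_of_nonneg_of_le_pi hx h2]
  · have := Real.sin_le (show 0 ≤ -x by linarith)
    rw [Real.sin_neg] at this
    linarith

/-- **The bend arc solves the bend field** on the time interval `(-1/10, 11/10)` (`ρ > 0`): along
it the coordinates are `(ρ sin x, ρ cos x)`, the normal part vanishes, the squared coordinate radius
is `ρ²`, and the angular cut-off is `1` because `sin x ≥ -1/5`. [folklore] -/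
theorem hasDerivAt_bendArc (hσ : σ ^ 2 = 1) {rA ρ : ℝ} (hρ : 0 < ρ) {t : ℝ} (ht : t ∈ Ioo (-(1 / 10) : ℝ) (11 / 10)) :
    HasDerivAt (bendArc σ rA ρ) (bendField σ rA (bendArc σ rA ρ t)) t := by
  set c := annulusCut rA (ρ ^ 2) with hc
  have hc01 : c ∈ Icc (0 : ℝ) 1 := annulusCut_mem_Icc rA (ρ ^ 2)
  set x := π / 2 * c * t with hx
  -- coordinates along the arc
  have hv : bendArc σ rA ρ t - cO σ = (ρ * Real.sin x) • dLo σ + (ρ * Real.cos x) • dHi σ := by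
    rw [bendArc]; abel
  have ha : aCL σ (bendArc σ rA ρ t - cO σ) = ρ * Real.sin x := by
    rw [hv, map_add, map_smul, map_smul, aCL_dLo hσ, aCL_dHi hσ]; simp
  have hb : bCL σ (bendArc σ rA ρ t - cO σ) = ρ * Real.cos x := by
    rw [hv, map_add, map_smul, map_smul, bCL_dLo hσ, bCL_dHi hσ]; simp
  have hq : (ρ * Real.sin x) ^ 2 + (ρ * Real.cos x) ^ 2 = ρ ^ 2 := by
    have := Real.sin_sq_add_cos_sq x; nlinarith
  have hperp : vPerp σ (bendArc σ rA ρ t - cO σ) = 0 := by rw [hv]; exact vPerp_of_mem hσ _ _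
  -- the angular cut-off is `1`
  have hπ := Real.pi_gt_three
  have hπ4 := Real.pi_le_four
  have hxlo : -(1 / 5) ≤ x := by
    rw [hx]
    have : -(1 / 10) * (π / 2 * c) ≤ t * (π / 2 * c) := mul_le_mul_of_nonneg_right ht.1.le (by nlinarith [hc01.1])
    nlinarith [hc01.1, hc01.2]
  have hxhi : x ≤ π := by
    rw [hx]
    have : t * (π / 2 * c) ≤ 11 / 10 * (π / 2 * c) := mul_le_mul_of_nonneg_right ht.2.le (by nlinarith [hc01.1])
    nlinarith [hc01.1, hc01.2]
  have hang : angCut (ρ * Real.sin x) (ρ * Real.cos x) = 1 := by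
    refine angCut_of_ge ?_
    have e : ρ * Real.sin x / Real.sqrt ((ρ * Real.sin x) ^ 2 + (ρ * Real.cos x) ^ 2) = Real.sin x := by
      rw [hq, Real.sqrt_sq hρ.le]; field_simp
    rw [e]
    exact neg_fifth_le_sin hxlo hxhi
  have hcoeff : bendCoeff σ rA (bendArc σ rA ρ t) = c := by
    rw [bendCoeff, ha, hb, hq, hperp, norm_zero, hang]
    simp [slabCut_zero, hc]
  -- the derivative of the arc
  have h1 : HasDerivAt (fun t : ℝ ↦ π / 2 * c * t) (π / 2 * c) t := by
    simpa using (hasDerivAt_id t).const_mul (π / 2 * c)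
  have hsin : HasDerivAt (fun t : ℝ ↦ ρ * Real.sin (π / 2 * c * t)) (ρ * (Real.cos x * (π / 2 * c))) t :=
    (h1.sin).const_mul ρ
  have hcos : HasDerivAt (fun t : ℝ ↦ ρ * Real.cos (π / 2 * c * t)) (ρ * (-Real.sin x * (π / 2 * c))) t :=
    (h1.cos).const_mul ρ
  have hd : HasDerivAt (bendArc σ rA ρ)
      ((ρ * (Real.cos x * (π / 2 * c))) • dLo σ + (ρ * (-Real.sin x * (π / 2 * c))) • dHi σ) t := by
    have h2 := ((hsin.smul_const (dLo σ)).add (hcos.smul_const (dHi σ))).const_add (cO σ)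
    have e : bendArc σ rA ρ = fun t ↦ cO σ + ((ρ * Real.sin (π / 2 * c * t)) • dLo σ + (ρ * Real.cos (π / 2 * c * t)) • dHi σ) := by
      funext t'; rw [bendArc, hc, add_assoc]
    rw [e]; exact h2
  convert hd using 1
  rw [bendField, hcoeff, ha, hb, smul_sub, smul_smul, smul_smul]
  have e1 : π / 2 * c * (ρ * Real.cos x) = ρ * (Real.cos x * (π / 2 * c)) := by ring
  have e2 : π / 2 * c * (ρ * Real.sin x) = -(ρ * (-Real.sin x * (π / 2 * c))) := by ring
  rw [e1, e2, neg_smul, sub_neg_eq_add]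


/-- The lower ray point of parameter `t`: `(1 - 3t/4, -t, σ (1 - t)) = O - t dLo`. [folklore] -/
theorem rayLo_eq (t : ℝ) : (pt3 (1 - 3 * t / 4) (-t) (σ * (1 - t)) : 𝔼 3) = cO σ - t • dLo σ := by
  ext i; fin_cases i <;> simp [cO, dLo, pt3] <;> ring

/-- The upper ray point of parameter `t`: `(1 - 3t/4, t, σ (1 - t)) = O + t dHi`. [folklore] -/
theorem rayHi_eq (t : ℝ) : (pt3 (1 - 3 * t / 4) t (σ * (1 - t)) : 𝔼 3) = cO σ + t • dHi σ := by
  ext i; fin_cases i <;> simp [cO, dHi, pt3] <;> ring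

/-- The upper line point `lineHi α - O = (1 - s) dHi`, `s = (α - 1/4)/(3/4)`. [folklore] -/
theorem lineHi_sub_cO (α : ℝ) : lineHi σ α - cO σ = (1 - (α - 1 / 4) / (3 / 4)) • dHi σ := by
  ext i; fin_cases i <;> simp [cO, dHi, lineHi, pt3] <;> ring

/-- The lower line point `lineLo α - O = -(1 - s) dLo`. [folklore] -/
theorem lineLo_sub_cO (α : ℝ) : lineLo σ α - cO σ = (-(1 - (α - 1 / 4) / (3 / 4))) • dLo σ := by
  ext i; fin_cases i <;> simp [cO, dLo, lineLo, pt3] <;> ring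

/-- `‖O‖ ≤ 2` for `|σ| ≤ 1`. [folklore] -/
theorem norm_cO_le (h : |σ| ≤ 1) : ‖cO σ‖ ≤ 2 := by
  refine (BandData.norm_pt3_le _ _ _).trans ?_
  simp; linarith

/-- **Coordinate estimate**: `α(v)² + β(v)² ≤ (169/200) ‖v‖²` (`σ² = 1`). [folklore] -/
theorem coord_sq_le (hσ : σ ^ 2 = 1) (v : 𝔼 3) : (aCL σ v) ^ 2 + (bCL σ v) ^ 2 ≤ 169 / 200 * ‖v‖ ^ 2 := by
  have ha := abs_aCL_le (σ := σ) v
  have hb := abs_bCL_le (σ := σ) v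
  have h1 := norm_dLoDual_le hσ
  have h2 := norm_dHiDual_le hσ
  have ha' : |aCL σ v| ≤ 13 / 20 * ‖v‖ := ha.trans (mul_le_mul_of_nonneg_right h1 (norm_nonneg _))
  have hb' : |bCL σ v| ≤ 13 / 20 * ‖v‖ := hb.trans (mul_le_mul_of_nonneg_right h2 (norm_nonneg _))
  have e1 : (aCL σ v) ^ 2 = |aCL σ v| ^ 2 := (sq_abs _).symm
  have e2 : (bCL σ v) ^ 2 = |bCL σ v| ^ 2 := (sq_abs _).symm
  rw [e1, e2]
  nlinarith [abs_nonneg (aCL σ v), abs_nonneg (bCL σ v), norm_nonneg v]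

/-- The first coordinate of the model lower rail point `(α, -1, 0) - O`: `(6α)/25 - 53/50`. [folklore] -/
theorem aCL_modelLo_sub_cO (hσ : σ ^ 2 = 1) (α : ℝ) : aCL σ (pt3 α (-1) 0 - cO σ) = 6 * α / 25 - 53 / 50 := by
  have e : (pt3 α (-1) 0 : 𝔼 3) - cO σ = pt3 (α - 1) (-1) (-σ) := by
    ext i; fin_cases i <;> simp [cO, pt3]
  rw [e, aCL_apply, dLoDual, inner_pt3_pt3]; nlinarith

/-- The second coordinate of the model upper rail point `(α, 1, 0) - O`: `53/50 - (6α)/25`. [folklore] -/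
theorem bCL_modelHi_sub_cO (hσ : σ ^ 2 = 1) (α : ℝ) : bCL σ (pt3 α 1 0 - cO σ) = 53 / 50 - 6 * α / 25 := by
  have e : (pt3 α 1 0 : 𝔼 3) - cO σ = pt3 (α - 1) 1 (-σ) := by
    ext i; fin_cases i <;> simp [cO, pt3]
  rw [e, bCL_apply, dHiDual, inner_pt3_pt3]; nlinarith

end ExitBend

namespace BandData

open ExitBend

variable {A B K : Knot} {avoid : Set (𝕊 3)} (b : BandData A B K avoid)
  (hcross : b.band ⁻¹' sphereEquator 2 ∩ squareNhd b.δ = {x ∈ squareNhd b.δ | x 0 = 2⁻¹})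

/-! ### The bend field of band-sum data in the chart -/

/-- **The bend field in the chart `ψ`**: `V(y) = κ frame (bendField (blowUp y))` (push-forward of the
blow-up field along the affine blow-down map), at the sign `σ = depthSign`. [folklore] -/
def bendChartField (κ rA : ℝ) (y : 𝔼 3) : 𝔼 3 :=
  κ • b.frame hcross (bendField b.depthSign rA (b.blowUp hcross κ y))

/-- The blow-up map is `C^∞`. [folklore] -/
theorem contDiff_blowUp (κ : ℝ) : ContDiff ℝ ∞ (b.blowUp hcross κ) :=
  (((b.frame hcross).symm : (𝔼 3) ≃L[ℝ] 𝔼 3) : (𝔼 3) →L[ℝ] 𝔼 3).contDiff.comp (contDiff_id.sub contDiff_const)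
    |>.const_smul κ⁻¹

/-- The bend field in the chart is `C^∞` (`r_A > 0`). [folklore] -/
theorem contDiff_bendChartField (κ : ℝ) {rA : ℝ} (hrA : 0 < rA) : ContDiff ℝ ∞ (b.bendChartField hcross κ rA) :=
  ((((b.frame hcross : (𝔼 3) ≃L[ℝ] 𝔼 3) : (𝔼 3) →L[ℝ] 𝔼 3).contDiff.comp
    ((contDiff_bendField _ hrA).comp (b.contDiff_blowUp hcross κ))).const_smul κ)

/-- **The bend field in the chart has compact support** (inside the blow-down of the ball of
radius `2` about `O`). [folklore] -/
theorem hasCompactSupport_bendChartField {κ : ℝ} (hκ : κ ≠ 0) (rA : ℝ) :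
    HasCompactSupport (b.bendChartField hcross κ rA) := by
  refine HasCompactSupport.intro ((isCompact_closedBall (cO b.depthSign) 2).image (b.contDiff_blowDown hcross κ).continuous) ?_
  intro y hy
  have hY : b.blowUp hcross κ y ∉ closedBall (cO b.depthSign) 2 := fun hmem ↦
    hy ⟨_, hmem, b.blowDown_blowUp hcross hκ y⟩
  rw [mem_closedBall, dist_eq_norm, not_le] at hY
  rw [bendChartField, bendField_eq_zero_of_two_le _ b.depthSign_sq hY.le, map_zero, smul_zero]

/-- The bend vector field on `𝕊³` (push-forward through `ψ`) is smooth. [folklore] -/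
theorem contMDiff_bendField (κ : ℝ) (hκ : κ ≠ 0) {rA : ℝ} (hrA : 0 < rA) :
    ContMDiff 𝓘(ℝ, 𝔼 3) 𝓘(ℝ, 𝔼 3).tangent ∞
      fun x => (⟨x, chartField psiN (b.bendChartField hcross κ rA) x⟩ : TangentBundle 𝓘(ℝ, 𝔼 3) (𝕊 3)) :=
  isFullChart_psiN.contMDiff_chartField (b.contDiff_bendChartField hcross κ hrA) (b.hasCompactSupport_bendChartField hcross hκ rA)

/-- **The bend isotopy**: the ambient isotopy of `𝕊³` generated by the bend field, run for unit
time. [cite: HirschDT1976, Ch. 8 §1, Thm. 1.2] -/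
def bendIsotopy {κ : ℝ} (hκ : κ ≠ 0) {rA : ℝ} (hrA : 0 < rA) : AmbientIsotopy (𝓡 3) (𝕊 3) :=
  flowIsotopyAt (b.contMDiff_bendField hcross κ hκ hrA) 1

/-- The end stage of the bend isotopy is the time-one map of the flow. [folklore] -/
theorem bendIsotopy_toFun_one {κ : ℝ} (hκ : κ ≠ 0) {rA : ℝ} (hrA : 0 < rA) (x : 𝕊 3) :
    (b.bendIsotopy hcross hκ hrA).toFun 1 x = flow (b.contMDiff_bendField hcross κ hκ hrA) x 1 := by
  rw [bendIsotopy, flowIsotopyAt_toFun_one]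

/-! ### Fixed points and tracks of the bend flow -/

/-- **Zeros of the blow-up field are fixed**: if `bendField (blowUp y) = 0` then `ψ⁻¹ y` does not
move. [folklore] -/
theorem bend_flow_symm_eq_self {κ : ℝ} (hκ : κ ≠ 0) {rA : ℝ} (hrA : 0 < rA) {y : 𝔼 3}
    (hy : bendField b.depthSign rA (b.blowUp hcross κ y) = 0) (t : ℝ) :
    flow (b.contMDiff_bendField hcross κ hκ hrA) (psiN.symm y) t = psiN.symm y := by
  refine isFullChart_psiN.flow_chartField_symm_eq_self (b.contDiff_bendChartField hcross κ hrA)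
    (b.hasCompactSupport_bendChartField hcross hκ rA) (fun y' hy' ↦ ?_) t
  have : y' = y := by rw [← psiN_apply_psiN_symm y', hy', psiN_apply_psiN_symm]
  rw [this, bendChartField, hy, map_zero, smul_zero]

/-- The north pole is fixed. [folklore] -/
theorem bend_flow_northPole {κ : ℝ} (hκ : κ ≠ 0) {rA : ℝ} (hrA : 0 < rA) (t : ℝ) :
    flow (b.contMDiff_bendField hcross κ hκ hrA) northPole t = northPole :=
  isFullChart_psiN.flow_chartField_eq_self_of_not_mem_source (b.contDiff_bendChartField hcross κ hrA)
    (b.hasCompactSupport_bendChartField hcross hκ rA) (by simp [psiN_source]) t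

/-- A point of the sphere whose chart value (if it is not the north pole) is a zero of the blow-up
field is fixed. [folklore] -/
theorem bend_flow_eq_self {κ : ℝ} (hκ : κ ≠ 0) {rA : ℝ} (hrA : 0 < rA) {x : 𝕊 3}
    (hx : x ≠ northPole → bendField b.depthSign rA (b.blowUp hcross κ (psiN x)) = 0) (t : ℝ) :
    flow (b.contMDiff_bendField hcross κ hκ hrA) x t = x := by
  by_cases hN : x = northPole
  · rw [hN]; exact b.bend_flow_northPole hcross hκ hrA t
  · have e : x = psiN.symm (psiN x) := (psiN_symm_apply_psiN hN).symm
    have h1 := b.bend_flow_symm_eq_self hcross hκ hrA (hx hN) t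
    rwa [← e] at h1

/-- **The track of an upper spike point**: `ψ⁻¹ (blowDown (O + ρ dHi))`, `ρ > 0`, is carried in
unit time to `ψ⁻¹ (blowDown (bendArc ρ 1))`. [cite: LeeSmoothManifolds2013, Thm. 9.12] -/
theorem bend_flow_upperRay {κ : ℝ} (hκ : κ ≠ 0) {rA : ℝ} (hrA : 0 < rA) {ρ : ℝ} (hρ : 0 < ρ) :
    flow (b.contMDiff_bendField hcross κ hκ hrA) (psiN.symm (b.blowDown hcross κ (cO b.depthSign + ρ • dHi b.depthSign))) 1 =
      psiN.symm (b.blowDown hcross κ (bendArc b.depthSign rA ρ 1)) := by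
  have h0 : (0 : ℝ) ∈ Ioo (-(1 / 10) : ℝ) (11 / 10) := by norm_num
  have h1 : (1 : ℝ) ∈ Ioo (-(1 / 10) : ℝ) (11 / 10) := by norm_num
  have hγ : ∀ s ∈ Ioo (-(1 / 10) : ℝ) (11 / 10),
      HasDerivAt (fun s ↦ b.blowDown hcross κ (bendArc b.depthSign rA ρ s))
        (b.bendChartField hcross κ rA (b.blowDown hcross κ (bendArc b.depthSign rA ρ s))) s := by
    intro s hs
    have ha := hasDerivAt_bendArc b.depthSign b.depthSign_sq (rA := rA) hρ hs
    have hf := (((b.frame hcross : (𝔼 3) ≃L[ℝ] 𝔼 3) : (𝔼 3) →L[ℝ] 𝔼 3).hasFDerivAt.comp_hasDerivAt s ha)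
    have h2 := (hf.const_smul κ).const_add b.pZero
    rw [bendChartField, b.blowUp_blowDown hcross hκ]
    exact h2
  have key := isFullChart_psiN.flow_chartField_symm (b.contDiff_bendChartField hcross κ hrA)
    (b.hasCompactSupport_bendChartField hcross hκ rA) h0 hγ h1
  simpa [bendArc_zero] using key

/-! ### The bent knot of a wall frame -/

variable {hcross} {ε r A' κ : ℝ} (HU : b.ShrinkScaleU hcross ε r A' κ) {F : ℝ → 𝔼 4}
  (hW : b.IsWallFrame HU.cone F) {lam₀ rA : ℝ}

/-- **The bent knot**: the image of the shrunk wall frame knot (ratio `λ₀`) under the end stage of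
the bend isotopy. [folklore] -/
def bentKnot (hl : lam₀ ∈ Ioc (0 : ℝ) 1) (hrA : 0 < rA) (hB : B.InSouth) (hAB : Disjoint (range A) (range B)) : Knot :=
  (b.wallShrinkKnotU HU hW hl hB hAB).map ((b.bendIsotopy hcross HU.cone.spike.κ_pos.ne' hrA).toDiffeomorph 1)

/-- **The shrunk wall frame knot is isotopic to the bent knot** (end stage of an ambient isotopy).
[cite: HirschDT1976, Ch. 8 §1, Thm. 1.2] -/
theorem isIsotopic_wallShrinkKnotU_bentKnot (hl : lam₀ ∈ Ioc (0 : ℝ) 1) (hrA : 0 < rA) (hB : B.InSouth)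
    (hAB : Disjoint (range A) (range B)) :
    (b.wallShrinkKnotU HU hW hl hB hAB).IsIsotopic (b.bentKnot HU hW hl hrA hB hAB) :=
  SphereEmbedding.isIsotopic_map _ _

/-- **The knot of the wall frame is isotopic to the bent knot.** [cite: HirschDT1976, Ch. 8 §1, Thm. 1.3] -/
theorem isIsotopic_frameKnot_bentKnot (hl : lam₀ ∈ Ioc (0 : ℝ) 1) (hrA : 0 < rA) (hB : B.InSouth)
    (hAB : Disjoint (range A) (range B)) :
    (b.frameKnot hW).IsIsotopic (b.bentKnot HU hW hl hrA hB hAB) :=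
  IsAmbientIsotopic.trans_holds (b.isIsotopic_frameKnot_wallShrinkKnotU HU hW hl hB hAB)
    (b.isIsotopic_wallShrinkKnotU_bentKnot HU hW hl hrA hB hAB)

/-- The bent knot on a circle point: the time-one flow of the shrunk loop. [folklore] -/
theorem bentKnot_circlePt (hl : lam₀ ∈ Ioc (0 : ℝ) 1) (hrA : 0 < rA) (hB : B.InSouth)
    (hAB : Disjoint (range A) (range B)) (t : ℝ) :
    b.bentKnot HU hW hl hrA hB hAB (circlePt t) =
      flow (b.contMDiff_bendField hcross κ HU.cone.spike.κ_pos.ne' hrA) (b.wallShrinkKnotU HU hW hl hB hAB (circlePt t)) 1 := by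
  rw [bentKnot, SphereEmbedding.map_apply, AmbientIsotopy.coe_toDiffeomorph, bendIsotopy_toFun_one]

/-- The shrunk loop on the fundamental domain. [folklore] -/
theorem coe_wallShrinkKnotU_circlePt_of_mem (hl : lam₀ ∈ Ioc (0 : ℝ) 1) (hB : B.InSouth)
    (hAB : Disjoint (range A) (range B)) {t : ℝ} (ht : t ∈ Ico b.alo (b.alo + 1)) :
    ((b.wallShrinkKnotU HU hW hl hB hAB (circlePt t) : 𝕊 3) : 𝔼 4) = b.wallScalePiece HU.cone F lam₀ 1 t := by
  rw [b.coe_wallShrinkKnotU_circlePt, periodise_eq_self b.alo _ ht]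

/-! ### Clear wall frames; the walls, the lower spike and the unit are fixed -/

omit HU hW in
/-- **Clear wall frames** (for the bend): every point of `F` off the content set is either the
corresponding point of the spiked knot of `b`, or a point of the sphere whose chart value (off the
north pole) lies at blow-up distance `≥ 2` from the centre `O`. [folklore] -/
def IsBendClear (h : b.ConeScale hcross ε r A' κ) (F : ℝ → 𝔼 4) : Prop :=
  ∀ t ∈ Ico b.alo (b.alo + 1), t ∉ b.contentSet h.spike.κ_pos h.spike.seven_le_gapLo h.spike.seven_le_gapHi →
    F t = b.spikePiece hcross κ b.depthSign 1 t ∨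
      ∃ x' : 𝕊 3, F t = (x' : 𝔼 4) ∧ (x' ≠ northPole → 2 ≤ ‖b.blowUp hcross κ (psiN x') - cO b.depthSign‖)

omit HU hW in
/-- The spiked piece function itself is clear. [folklore] -/
theorem isBendClear_spikePiece (h : b.ConeScale hcross ε r A' κ) : b.IsBendClear h (b.spikePiece hcross κ b.depthSign 1) :=
  fun _ _ _ ↦ Or.inl rfl

include HU in
/-- **Flat lower walls have first coordinate `≤ -3/4`**: for `α < 3/8` flat (`ε ≤ 1/16`),
`α(blowUp (pieceLo 1 α) - O) ≤ -3/4` (the final lower piece is a convex combination of the rail,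
within `ε(|α|+1)` of `(α, -1, 0)`, and of the lower line, `-(1 - s) dLo` from `O`). [folklore] -/
theorem aCL_blowUp_pieceLo_one_le {α : ℝ} (hα : α < 3 / 8) (hsc : κ * (|α| + 1) < r) :
    aCL b.depthSign (b.blowUp hcross κ (b.pieceLo hcross κ b.depthSign 1 α) - cO b.depthSign) ≤ -(3 / 4) := by
  have h := HU.cone
  have hκ := h.spike.κ_pos
  have hf := h.spike.flat
  have hε := h.eps_le
  have hεn := hf.eps_nonneg
  have hσ := b.depthSign_sq
  set β := spikeBump α
  have hβ : β ∈ Icc (0 : ℝ) 1 := spikeBump_mem_Icc α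
  set R := b.blowUp hcross κ (b.railLoPsi κ α)
  have hY : b.blowUp hcross κ (b.pieceLo hcross κ b.depthSign 1 α) - cO b.depthSign =
      (1 - β) • (R - cO b.depthSign) + β • (lineLo b.depthSign α - cO b.depthSign) := by
    rw [b.blowUp_pieceLo hcross hκ.ne', one_mul, modelLo_of_le (by linarith)]
    module
  -- the rail term
  have hRm : ‖R - pt3 α (-1) 0‖ ≤ ε * (|α| + 1) := b.norm_blowUp_railLoPsi_sub_le hf hκ hsc
  have haR : aCL b.depthSign (R - cO b.depthSign) ≤ 6 * α / 25 - 53 / 50 + 13 / 20 * (ε * (|α| + 1)) := by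
    have e : R - cO b.depthSign = (pt3 α (-1) 0 - cO b.depthSign) + (R - pt3 α (-1) 0) := by abel
    rw [e, map_add, aCL_modelLo_sub_cO _ hσ]
    have h1 := abs_aCL_le (σ := b.depthSign) (R - pt3 α (-1) 0)
    have h2 := norm_dLoDual_le hσ
    have h3 : |aCL b.depthSign (R - pt3 α (-1) 0)| ≤ 13 / 20 * (ε * (|α| + 1)) :=
      h1.trans ((mul_le_mul_of_nonneg_right h2 (norm_nonneg _)).trans (mul_le_mul_of_nonneg_left hRm (by norm_num)))
    linarith [(abs_le.1 h3).2]
  have haR' : aCL b.depthSign (R - cO b.depthSign) ≤ -(3 / 4) := by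
    rcases le_or_gt 0 α with h0 | h0
    · rw [abs_of_nonneg h0] at haR; nlinarith
    · rw [abs_of_neg h0] at haR; nlinarith
  -- the line term
  have haL : aCL b.depthSign (lineLo b.depthSign α - cO b.depthSign) ≤ -(3 / 4) := by
    rw [lineLo_sub_cO, map_smul, aCL_dLo hσ, smul_eq_mul, mul_one]
    have : (α - 1 / 4) / (3 / 4) = (4 * α - 1) / 3 := by field_simp
    rw [this]; linarith
  rw [hY, map_add, map_smul, map_smul, smul_eq_mul, smul_eq_mul]
  exact (convexComb_le_max hβ).trans (max_le haR' haL)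

include HU in
/-- **Flat upper walls have second coordinate `≥ 3/4`.** [folklore] -/
theorem le_bCL_blowUp_pieceHi_one {α : ℝ} (hα : α < 3 / 8) (hsc : κ * (|α| + 1) < r) :
    3 / 4 ≤ bCL b.depthSign (b.blowUp hcross κ (b.pieceHi hcross κ b.depthSign 1 α) - cO b.depthSign) := by
  have h := HU.cone
  have hκ := h.spike.κ_pos
  have hf := h.spike.flat
  have hε := h.eps_le
  have hεn := hf.eps_nonneg
  have hσ := b.depthSign_sq
  set β := spikeBump α
  have hβ : β ∈ Icc (0 : ℝ) 1 := spikeBump_mem_Icc α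
  set R := b.blowUp hcross κ (b.railHiPsi κ α)
  have hY : b.blowUp hcross κ (b.pieceHi hcross κ b.depthSign 1 α) - cO b.depthSign =
      (1 - β) • (R - cO b.depthSign) + β • (lineHi b.depthSign α - cO b.depthSign) := by
    rw [b.blowUp_pieceHi hcross hκ.ne', one_mul, modelHi_of_le (by linarith)]
    module
  have hRm : ‖R - pt3 α 1 0‖ ≤ ε * (|α| + 1) := b.norm_blowUp_railHiPsi_sub_le hf hκ hsc
  have hbR : 53 / 50 - 6 * α / 25 - 13 / 20 * (ε * (|α| + 1)) ≤ bCL b.depthSign (R - cO b.depthSign) := by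
    have e : R - cO b.depthSign = (pt3 α 1 0 - cO b.depthSign) + (R - pt3 α 1 0) := by abel
    rw [e, map_add, bCL_modelHi_sub_cO _ hσ]
    have h1 := abs_bCL_le (σ := b.depthSign) (R - pt3 α 1 0)
    have h2 := norm_dHiDual_le hσ
    have h3 : |bCL b.depthSign (R - pt3 α 1 0)| ≤ 13 / 20 * (ε * (|α| + 1)) :=
      h1.trans ((mul_le_mul_of_nonneg_right h2 (norm_nonneg _)).trans (mul_le_mul_of_nonneg_left hRm (by norm_num)))
    linarith [(abs_le.1 h3).1]
  have hbR' : 3 / 4 ≤ bCL b.depthSign (R - cO b.depthSign) := by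
    rcases le_or_gt 0 α with h0 | h0
    · rw [abs_of_nonneg h0] at hbR; nlinarith
    · rw [abs_of_neg h0] at hbR; nlinarith
  have hbL : 3 / 4 ≤ bCL b.depthSign (lineHi b.depthSign α - cO b.depthSign) := by
    rw [lineHi_sub_cO, map_smul, bCL_dHi hσ, smul_eq_mul, mul_one]
    have : (α - 1 / 4) / (3 / 4) = (4 * α - 1) / 3 := by field_simp
    rw [this]; linarith
  rw [hY, map_add, map_smul, map_smul, smul_eq_mul, smul_eq_mul]
  exact (le_min hbR' hbL).trans (min_le_convexComb hβ)

include HU in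
/-- **Far points are at blow-up distance `≥ 2` from `O`**: a point of the far set of threshold
`min (r/2) (min gapLo gapHi)`, not the north pole, has chart value of blow-up norm `> 9`
(`far_half`), hence blow-up distance `≥ 7` from `O`. [folklore] -/
theorem two_le_norm_blowUp_sub_cO_of_mem_farSet {x : 𝕊 3}
    (hx : (x : 𝔼 4) ∈ b.farSet (min (r / 2) (min b.gapLo b.gapHi))) (hN : x ≠ northPole) :
    2 ≤ ‖b.blowUp hcross κ (psiN x) - cO b.depthSign‖ := by
  have h := HU.cone
  have hκ := h.spike.κ_pos
  obtain ⟨m, ρ₀, hm, hρ₀, hκρ⟩ := h.far_half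
  set y := psiN x
  set N := ‖((b.frame hcross : (𝔼 3) ≃L[ℝ] 𝔼 3) : (𝔼 3) →L[ℝ] 𝔼 3)‖
  have hfar : ρ₀ ≤ ‖y - b.pZero‖ := by
    by_contra hlt
    push Not at hlt
    have h1 := hρ₀ y hlt
    rw [show psiN.symm y = x from psiN_symm_apply_psiN hN] at h1
    linarith [hm _ hx]
  have h2 : ‖y - b.pZero‖ ≤ κ * N * ‖b.blowUp hcross κ y‖ := b.norm_sub_pZero_le hκ (hcross := hcross) y
  have hN0 : 0 ≤ κ * N := mul_nonneg hκ.le (norm_nonneg _)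
  have h9 : 9 < ‖b.blowUp hcross κ y‖ := by
    by_contra hle
    push Not at hle
    have : κ * N * ‖b.blowUp hcross κ y‖ ≤ κ * N * 9 := mul_le_mul_of_nonneg_left hle hN0
    linarith
  have hO : ‖cO b.depthSign‖ ≤ 2 := norm_cO_le _ b.abs_depthSign_le
  have := norm_sub_norm_le (b.blowUp hcross κ y) (cO b.depthSign)
  linarith

/-- **The walls are fixed by the bend flow**: for a clear wall frame in normal position (`A`
north), the point of the frame at a parameter off the content set does not move. [folklore] -/
theorem bend_flow_wall (hclear : b.IsBendClear HU.cone F) (hA : A.InNorth) {rA : ℝ} (hrA : 0 < rA) {t : ℝ}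
    (ht : t ∈ Ico b.alo (b.alo + 1))
    (hts : t ∉ b.contentSet HU.cone.spike.κ_pos HU.cone.spike.seven_le_gapLo HU.cone.spike.seven_le_gapHi)
    {x : 𝕊 3} (hx : (x : 𝔼 4) = F t) :
    flow (b.contMDiff_bendField hcross κ HU.cone.spike.κ_pos.ne' hrA) x 1 = x := by
  have h := HU.cone
  have hκ := h.spike.κ_pos
  have hσ := b.depthSign_sq
  refine b.bend_flow_eq_self hcross hκ.ne' hrA (fun hN ↦ ?_) 1
  rcases hclear t ht hts with he | ⟨x', hx', hfar'⟩
  · rcases b.wall_cases h hA ht hts with ⟨-, hαt, hqt, hwt⟩ | ⟨-, hαt, hqt, hwt⟩ | ⟨hfar, x₀, hx₀, -⟩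
    · have hxe : x = psiN.symm (b.pieceLo hcross κ b.depthSign 1 (b.alphaLo κ t)) := Subtype.ext (hx.trans (he.trans hwt))
      rw [hxe, psiN_apply_psiN_symm]
      refine bendField_eq_zero_of_radius_ge _ ?_
      have ha := b.aCL_blowUp_pieceLo_one_le HU hαt hqt
      nlinarith
    · have hxe : x = psiN.symm (b.pieceHi hcross κ b.depthSign 1 (b.alphaHi κ t)) := Subtype.ext (hx.trans (he.trans hwt))
      rw [hxe, psiN_apply_psiN_symm]
      refine bendField_eq_zero_of_radius_ge _ ?_
      have hb := b.le_bCL_blowUp_pieceHi_one HU hαt hqt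
      nlinarith
    · have hxe : x = x₀ := Subtype.ext (hx.trans (he.trans hx₀))
      rw [hx₀, ← hxe] at hfar
      exact bendField_eq_zero_of_two_le _ hσ (b.two_le_norm_blowUp_sub_cO_of_mem_farSet HU hfar hN)
  · have hxe : x = x' := Subtype.ext (hx.trans hx')
    rw [hxe] at hN ⊢
    exact bendField_eq_zero_of_two_le _ hσ (hfar' hN)

/-! ### The bent knot pointwise -/

/-- Off the content set the bent knot is the wall frame. [folklore] -/
theorem bentKnot_circlePt_of_not_mem (hclear : b.IsBendClear HU.cone F) (hA : A.InNorth) (hl : lam₀ ∈ Ioc (0 : ℝ) 1)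
    (hrA : 0 < rA) (hB : B.InSouth) (hAB : Disjoint (range A) (range B)) {t : ℝ} (ht : t ∈ Ico b.alo (b.alo + 1))
    (hts : t ∉ b.contentSet HU.cone.spike.κ_pos HU.cone.spike.seven_le_gapLo HU.cone.spike.seven_le_gapHi) :
    ((b.bentKnot HU hW hl hrA hB hAB (circlePt t) : 𝕊 3) : 𝔼 4) = F t := by
  have hx : ((b.wallShrinkKnotU HU hW hl hB hAB (circlePt t) : 𝕊 3) : 𝔼 4) = F t := by
    rw [b.coe_wallShrinkKnotU_circlePt_of_mem HU hW hl hB hAB ht, b.wallScalePiece_eq_of_not_mem HU.cone hW hB lam₀ 1 hts]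
  rw [b.bentKnot_circlePt, b.bend_flow_wall HU hclear hA hrA ht hts hx, hx]

/-- A lower core parameter with `αLo ≥ 3/8` is a content parameter. [folklore] -/
theorem mem_contentSet_of_coreLo {t : ℝ} (ht : t ∈ Icc (b.tcLo - b.epsLo / 8) (b.tcLo + b.epsLo / 8))
    (hα : 3 / 8 ≤ b.alphaLo κ t) :
    t ∈ b.contentSet HU.cone.spike.κ_pos HU.cone.spike.seven_le_gapLo HU.cone.spike.seven_le_gapHi := by
  have h := HU.cone
  have hκ := h.spike.κ_pos
  have hjl := b.juncLo_spec hκ h.spike.seven_le_gapLo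
  have hjh := b.juncHi_mem_core hκ h.spike.seven_le_gapHi
  have hcc := b.coreLo_lt_coreHi
  refine ⟨?_, by linarith [ht.2, hjh.1]⟩
  by_contra hlt
  push Not at hlt
  have := b.alphaLo_lt_of_lt_juncLo hκ h.spike.seven_le_gapLo ht hlt
  linarith

/-- An upper core parameter with `αHi ≥ 3/8` is a content parameter. [folklore] -/
theorem mem_contentSet_of_coreHi {t : ℝ} (ht : t ∈ Icc (b.tcHi - b.epsHi / 8) (b.tcHi + b.epsHi / 8))
    (hα : 3 / 8 ≤ b.alphaHi κ t) :
    t ∈ b.contentSet HU.cone.spike.κ_pos HU.cone.spike.seven_le_gapLo HU.cone.spike.seven_le_gapHi := by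
  have h := HU.cone
  have hκ := h.spike.κ_pos
  have hjh := b.juncHi_spec hκ h.spike.seven_le_gapHi
  have hjl := b.juncLo_mem_core hκ h.spike.seven_le_gapLo
  have hcc := b.coreLo_lt_coreHi
  refine ⟨by linarith [ht.1, hjl.2], ?_⟩
  by_contra hlt
  push Not at hlt
  have := b.alphaHi_lt_of_juncHi_lt hκ h.spike.seven_le_gapHi ht hlt
  linarith

/-- The ray scalar at `u = 1` is positive on the straight spikes. [folklore] -/
theorem spikeScalar_one_pos (hl : lam₀ ∈ Ioc (0 : ℝ) 1) {α : ℝ} (hα : α < 1) : 0 < spikeScalar (1 * (1 - lam₀)) α :=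
  spikeScalar_pos (cParam_mem hl ⟨zero_le_one, le_rfl⟩) hα

/-- **On the lower straight spike the bent knot is the shrunk knot**: `ψ⁻¹ (oS + ψ₁(αLo t) (baseLo - oS))`
(the open lower ray consists of zeros of the field). [folklore] -/
theorem bentKnot_circlePt_lowerSpike (hl : lam₀ ∈ Ioc (0 : ℝ) 1) (hrA : 0 < rA) (hB : B.InSouth)
    (hAB : Disjoint (range A) (range B)) {t : ℝ} (ht : t ∈ Icc (b.tcLo - b.epsLo / 8) (b.tcLo + b.epsLo / 8))
    (hα : b.alphaLo κ t ∈ Icc (3 / 8 : ℝ) (3 / 4)) :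
    ((b.bentKnot HU hW hl hrA hB hAB (circlePt t) : 𝕊 3) : 𝔼 4) =
      ((psiN.symm (b.oS hcross κ b.depthSign + spikeScalar (1 * (1 - lam₀)) (b.alphaLo κ t) •
        (b.blowDown hcross κ (pt3 (1 / 4) (-1) 0) - b.oS hcross κ b.depthSign)) : 𝕊 3) : 𝔼 4) := by
  have h := HU.cone
  have hκ := h.spike.κ_pos
  have hσ := b.depthSign_sq
  have hmem := b.mem_contentSet_of_coreLo HU ht hα.1
  obtain ⟨hw1, hw2, hε⟩ := b.tcLo_window
  have ht' : t ∈ Ico b.alo (b.alo + 1) := b.contentSet_subset_Ico h hmem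
  set Z := b.oS hcross κ b.depthSign + spikeScalar (1 * (1 - lam₀)) (b.alphaLo κ t) •
    (b.blowDown hcross κ (pt3 (1 / 4) (-1) 0) - b.oS hcross κ b.depthSign)
  have hx : ((b.wallShrinkKnotU HU hW hl hB hAB (circlePt t) : 𝕊 3) : 𝔼 4) = ((psiN.symm Z : 𝕊 3) : 𝔼 4) := by
    rw [b.coe_wallShrinkKnotU_circlePt_of_mem HU hW hl hB hAB ht', b.wallScalePiece_eq_of_mem h hW lam₀ 1 hmem,
      b.scalePt_lowerSpike h ht ⟨by linarith [hα.1], hα.2⟩]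
  have hxe : b.wallShrinkKnotU HU hW hl hB hAB (circlePt t) = psiN.symm Z := Subtype.ext hx
  rw [b.bentKnot_circlePt, hxe, b.bend_flow_symm_eq_self hcross hκ.ne' hrA]
  rw [b.blowUp_rayLo h, rayLo_eq]
  exact bendField_lowerRay _ hσ (spikeScalar_one_pos hl (by linarith [hα.2]))

/-- **On the upper straight spike the bent knot is the bent arc**:
`ψ⁻¹ (blowDown (bendArc ψ₁(αHi t) 1))`. [folklore] -/
theorem bentKnot_circlePt_upperSpike (hl : lam₀ ∈ Ioc (0 : ℝ) 1) (hrA : 0 < rA) (hB : B.InSouth)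
    (hAB : Disjoint (range A) (range B)) {t : ℝ} (ht : t ∈ Icc (b.tcHi - b.epsHi / 8) (b.tcHi + b.epsHi / 8))
    (hα : b.alphaHi κ t ∈ Icc (3 / 8 : ℝ) (3 / 4)) :
    ((b.bentKnot HU hW hl hrA hB hAB (circlePt t) : 𝕊 3) : 𝔼 4) =
      ((psiN.symm (b.blowDown hcross κ (bendArc b.depthSign rA (spikeScalar (1 * (1 - lam₀)) (b.alphaHi κ t)) 1)) : 𝕊 3) : 𝔼 4) := by
  have h := HU.cone
  have hκ := h.spike.κ_pos
  have hmem := b.mem_contentSet_of_coreHi HU ht hα.1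
  have ht' : t ∈ Ico b.alo (b.alo + 1) := b.contentSet_subset_Ico h hmem
  set ψ₁ := spikeScalar (1 * (1 - lam₀)) (b.alphaHi κ t)
  have hψ : 0 < ψ₁ := spikeScalar_one_pos hl (by linarith [hα.2])
  set Z := b.oS hcross κ b.depthSign + ψ₁ • (b.blowDown hcross κ (pt3 (1 / 4) 1 0) - b.oS hcross κ b.depthSign)
  have hZ : Z = b.blowDown hcross κ (cO b.depthSign + ψ₁ • dHi b.depthSign) := by
    rw [← rayHi_eq, ← b.blowUp_rayHi h ψ₁, b.blowDown_blowUp hcross hκ.ne']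
  have hx : ((b.wallShrinkKnotU HU hW hl hB hAB (circlePt t) : 𝕊 3) : 𝔼 4) = ((psiN.symm Z : 𝕊 3) : 𝔼 4) := by
    rw [b.coe_wallShrinkKnotU_circlePt_of_mem HU hW hl hB hAB ht', b.wallScalePiece_eq_of_mem h hW lam₀ 1 hmem,
      b.scalePt_upperSpike h ht ⟨by linarith [hα.1], hα.2⟩]
  have hxe : b.wallShrinkKnotU HU hW hl hB hAB (circlePt t) = psiN.symm Z := Subtype.ext hx
  rw [b.bentKnot_circlePt, hxe, hZ, b.bend_flow_upperRay hcross hκ.ne' hrA hψ]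

/-- On the upper straight spike, where the ray scalar lies in `[2 r_A, 1/2]` (`r_A ≤ 1/4`), the bent
knot is the rigidly rotated point `ψ⁻¹ (blowDown (O + ψ₁ dLo))` of the lower line. [folklore] -/
theorem bentKnot_circlePt_upperSpike_of_mem (hl : lam₀ ∈ Ioc (0 : ℝ) 1) (hrA : 0 < rA) (hrA4 : rA ≤ 1 / 4)
    (hB : B.InSouth) (hAB : Disjoint (range A) (range B)) {t : ℝ}
    (ht : t ∈ Icc (b.tcHi - b.epsHi / 8) (b.tcHi + b.epsHi / 8)) (hα : b.alphaHi κ t ∈ Icc (3 / 8 : ℝ) (3 / 4))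
    (hψ : spikeScalar (1 * (1 - lam₀)) (b.alphaHi κ t) ∈ Icc (2 * rA) (1 / 2)) :
    ((b.bentKnot HU hW hl hrA hB hAB (circlePt t) : 𝕊 3) : 𝔼 4) =
      ((psiN.symm (b.blowDown hcross κ (cO b.depthSign + spikeScalar (1 * (1 - lam₀)) (b.alphaHi κ t) • dLo b.depthSign)) : 𝕊 3) : 𝔼 4) := by
  rw [b.bentKnot_circlePt_upperSpike HU hW hl hrA hB hAB ht hα, bendArc_one_of_eq_one]
  refine annulusCut_of_mem hrA ⟨by nlinarith [hψ.1, hrA.le], by nlinarith [hψ.1, hψ.2, hrA.le]⟩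

/-- On the upper straight spike, where the ray scalar is `≥ 3/4`, the bent knot is the shrunk knot.
[folklore] -/
theorem bentKnot_circlePt_upperSpike_of_ge (hl : lam₀ ∈ Ioc (0 : ℝ) 1) (hrA : 0 < rA)
    (hB : B.InSouth) (hAB : Disjoint (range A) (range B)) {t : ℝ}
    (ht : t ∈ Icc (b.tcHi - b.epsHi / 8) (b.tcHi + b.epsHi / 8)) (hα : b.alphaHi κ t ∈ Icc (3 / 8 : ℝ) (3 / 4))
    (hψ : 3 / 4 ≤ spikeScalar (1 * (1 - lam₀)) (b.alphaHi κ t)) :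
    ((b.bentKnot HU hW hl hrA hB hAB (circlePt t) : 𝕊 3) : 𝔼 4) =
      ((psiN.symm (b.blowDown hcross κ (cO b.depthSign + spikeScalar (1 * (1 - lam₀)) (b.alphaHi κ t) • dHi b.depthSign)) : 𝕊 3) : 𝔼 4) := by
  rw [b.bentKnot_circlePt_upperSpike HU hW hl hrA hB hAB ht hα, bendArc_of_eq_zero]
  exact annulusCut_of_ge (by nlinarith)

/-- **Blow-up norm of a content point**: `‖blowUp (Y s)‖ ≤ 7 + 4 ‖frame⁻¹‖ / κ` (local content of
parameter `≤ 4` by the model, the rest lies in the closed chart ball of radius `2`). [folklore] -/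
theorem norm_blowUp_Ypt_le (hB : B.InSouth) {s : ℝ}
    (hs : s ∈ b.contentSet HU.cone.spike.κ_pos HU.cone.spike.seven_le_gapLo HU.cone.spike.seven_le_gapHi) :
    ‖b.blowUp hcross κ (b.Ypt HU.cone s)‖ ≤ 7 + 4 * ‖(((b.frame hcross).symm : (𝔼 3) ≃L[ℝ] 𝔼 3) : (𝔼 3) →L[ℝ] 𝔼 3)‖ / κ := by
  have h := HU.cone
  have hκ := h.spike.κ_pos
  have hf := h.spike.flat
  have hε := h.eps_le
  have hεn := hf.eps_nonneg
  set N' := ‖(((b.frame hcross).symm : (𝔼 3) ≃L[ℝ] 𝔼 3) : (𝔼 3) →L[ℝ] 𝔼 3)‖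
  have hN' : 0 ≤ N' := norm_nonneg _
  have hdiv : 0 ≤ 4 * N' / κ := by positivity
  -- points of the closed chart ball of radius 2
  have south : ∀ {Y : 𝔼 3}, 0 < depth Y → ‖b.blowUp hcross κ Y‖ ≤ 7 + 4 * N' / κ := fun {Y} hY ↦ by
    have hY2 : ‖Y‖ < 2 := (depth_pos_iff Y).1 hY
    have h1 : ‖Y - b.pZero‖ ≤ 4 := by
      have := norm_sub_le Y b.pZero; rw [b.norm_pZero hcross] at this; linarith
    have h2 : ‖b.blowUp hcross κ Y‖ ≤ κ⁻¹ * (N' * ‖Y - b.pZero‖) := by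
      rw [blowUp, norm_smul, Real.norm_eq_abs, abs_of_pos (inv_pos.2 hκ)]
      exact mul_le_mul_of_nonneg_left ((((b.frame hcross).symm : (𝔼 3) ≃L[ℝ] 𝔼 3) : (𝔼 3) →L[ℝ] 𝔼 3).le_opNorm _)
        (inv_pos.2 hκ).le
    have h3 : κ⁻¹ * (N' * ‖Y - b.pZero‖) ≤ 4 * N' / κ :=
      calc κ⁻¹ * (N' * ‖Y - b.pZero‖) ≤ κ⁻¹ * (N' * 4) :=
            mul_le_mul_of_nonneg_left (mul_le_mul_of_nonneg_left h1 hN') (inv_pos.2 hκ).le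
        _ = 4 * N' / κ := by ring
    linarith
  rcases b.content_cases h hs with ⟨-, hαs, hqs, -, hY⟩ | ⟨-, hαs, hqs, -, hY⟩ | hfarS
  · by_cases h4 : b.alphaLo κ s ≤ 4
    · have hε1 : ε * (|b.alphaLo κ s| + 1) ≤ 1 := by rw [abs_of_nonneg (by linarith)]; nlinarith
      rw [hY]
      refine (b.norm_blowUp_pieceLo_le hf hκ ⟨zero_le_one, le_rfl⟩ _ hqs hε1).trans ?_
      rw [abs_of_nonneg (by linarith)]; linarith [b.abs_depthSign_le]
    · push Not at h4
      have hrail : b.Ypt h s = b.railLoPsi κ (b.alphaLo κ s) := by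
        rw [hY]; exact b.pieceLo_eq_rail hcross (fun hm ↦ by linarith [hm.2])
      rw [hrail]
      exact south (b.depth_railLoPsi_pos h hB (by linarith) (norm_railLoParam_lt hκ hqs))
  · by_cases h4 : b.alphaHi κ s ≤ 4
    · have hε1 : ε * (|b.alphaHi κ s| + 1) ≤ 1 := by rw [abs_of_nonneg (by linarith)]; nlinarith
      rw [hY]
      refine (b.norm_blowUp_pieceHi_le hf hκ ⟨zero_le_one, le_rfl⟩ _ hqs hε1).trans ?_
      rw [abs_of_nonneg (by linarith)]; linarith [b.abs_depthSign_le]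
    · push Not at h4
      have hrail : b.Ypt h s = b.railHiPsi κ (b.alphaHi κ s) := by
        rw [hY]; exact b.pieceHi_eq_rail hcross (fun hm ↦ by linarith [hm.2])
      rw [hrail]
      exact south (b.depth_railHiPsi_pos h hB (by linarith) (norm_railHiParam_lt hκ hqs))
  · exact south (b.depth_far_pos HU hfarS)

/-- **The unit is fixed**: on the general content (`αLo, αHi > 3/4`), if
`λ₀ (9 + 4 ‖frame⁻¹‖ / κ) ≤ r_A`, the bent knot is the shrunk knot `ψ⁻¹ (oS + λ₀ (Y - oS))` (its
squared coordinate radius is `≤ r_A²`). [folklore] -/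
theorem bentKnot_circlePt_general (hl : lam₀ ∈ Ioc (0 : ℝ) 1) (hrA : 0 < rA) (hB : B.InSouth)
    (hAB : Disjoint (range A) (range B))
    (hsmall : lam₀ * (9 + 4 * ‖(((b.frame hcross).symm : (𝔼 3) ≃L[ℝ] 𝔼 3) : (𝔼 3) →L[ℝ] 𝔼 3)‖ / κ) ≤ rA) {t : ℝ}
    (hs : t ∈ b.contentSet HU.cone.spike.κ_pos HU.cone.spike.seven_le_gapLo HU.cone.spike.seven_le_gapHi)
    (h1 : 3 / 4 < b.alphaLo κ t) (h2 : 3 / 4 < b.alphaHi κ t) :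
    ((b.bentKnot HU hW hl hrA hB hAB (circlePt t) : 𝕊 3) : 𝔼 4) =
      ((psiN.symm (b.oS hcross κ b.depthSign + lam₀ • (b.Ypt HU.cone t - b.oS hcross κ b.depthSign)) : 𝕊 3) : 𝔼 4) := by
  have h := HU.cone
  have hκ := h.spike.κ_pos
  have hσ := b.depthSign_sq
  have ht' : t ∈ Ico b.alo (b.alo + 1) := b.contentSet_subset_Ico h hs
  set Z := b.oS hcross κ b.depthSign + lam₀ • (b.Ypt h t - b.oS hcross κ b.depthSign)
  have hx : ((b.wallShrinkKnotU HU hW hl hB hAB (circlePt t) : 𝕊 3) : 𝔼 4) = ((psiN.symm Z : 𝕊 3) : 𝔼 4) := by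
    rw [b.coe_wallShrinkKnotU_circlePt_of_mem HU hW hl hB hAB ht', b.wallScalePiece_eq_of_mem h hW lam₀ 1 hs,
      b.scalePt_general h (by linarith) (by linarith)]
    congr 2
    simp only [Z]; congr 1; ring_nf
  have hxe : b.wallShrinkKnotU HU hW hl hB hAB (circlePt t) = psiN.symm Z := Subtype.ext hx
  rw [b.bentKnot_circlePt, hxe, b.bend_flow_symm_eq_self hcross hκ.ne' hrA]
  refine bendField_eq_zero_of_radius_le _ hrA ?_
  -- blow-up coordinates of `Z`: `λ₀ (blowUp Y - O)` from `O`
  have hbu : b.blowUp hcross κ Z - cO b.depthSign = lam₀ • (b.blowUp hcross κ (b.Ypt h t) - cO b.depthSign) := by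
    simp only [Z, b.blowUp_chord hcross hκ.ne', cO]
    module
  set v := b.blowUp hcross κ Z - cO b.depthSign
  have hv : ‖v‖ ≤ rA := by
    rw [show v = _ from hbu, norm_smul, Real.norm_eq_abs, abs_of_pos hl.1]
    have hY := b.norm_blowUp_Ypt_le HU hB hs
    have hO : ‖cO b.depthSign‖ ≤ 2 := norm_cO_le _ b.abs_depthSign_le
    have h3 : ‖b.blowUp hcross κ (b.Ypt h t) - cO b.depthSign‖ ≤ 9 + 4 * ‖(((b.frame hcross).symm : (𝔼 3) ≃L[ℝ] 𝔼 3) : (𝔼 3) →L[ℝ] 𝔼 3)‖ / κ := by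
      have := norm_sub_le (b.blowUp hcross κ (b.Ypt h t)) (cO b.depthSign); linarith
    exact (mul_le_mul_of_nonneg_left h3 hl.1.le).trans hsmall
  have hc := coord_sq_le _ hσ v
  nlinarith [norm_nonneg v]

end BandData

end Literature.Topology.FourManifolds
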